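/-
Copyright (c) 2026 the pub-hodgecm-mathlib formalisation cell (harness21).  Prover seat hodgecm-mathlib-K2E1-p13 (g0), Track B ∕ K2-LIT, h413 =
`stmt-HodgeConjecture-24833`, line `K2_E1_TraceFormulaBeta`, campaign «EIS-R7-BL-SPH-3» ∕ R8-LADDER-3, «MS-3» (σ1)₃+(σ2)₃ PAIRING SUPPLIER AT `N = 3`, §1-file = the CONVERGENT-TUBE
HALF (dealer K2E1-plan (g6) DEAL (40) 2026-09-04T10:06:38Z; census 10:09Z): the sesqui-holomorphic pairing `Φ(z,z′) = ⟪Λ^T E(z′), Λ^T E(z)⟫_{L²(X)}` of the truncated spherical Eisenstein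
series of `U(2,1)∕CM` on Godement's tube `{Re z > 2}` — the `N = 3` twin of ★ p859225 `K2E1MaassSelbergPairingCMTwo` (K2E4-p11 (g5)), letter-free.
-/
import Summits.HodgeConjecture.HodgeConjecture.Theorems.K2E1MaassSelbergPairingCMTwo                   -- ★ p859225 §A `pairing_of_differentiableOn` (generic Hilbert lemma, IMPORTED not restated); brings ★ `differentiableOn_of_weighted_bound`, ★ `differentiableOn_integral_of_dominated`
import Summits.HodgeConjecture.HodgeConjecture.Theorems.K2E1TruncatedEisensteinLocallyUniformCMThree   -- ★ locally uniform bound of `Λ^T E(φ,z)` on `U(J₃)`; brings ★ `…BoundedCMThree` (measurability, `L²`), ★ `…RegularCMThree` (holomorphy in `z`), ★ `…Explicit`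
import Summits.HodgeConjecture.HodgeConjecture.Theorems.K2E1MaassSelbergPoleControlSphericalCMThreeArch -- ★ (R3u)₃-sph `exists_bound_sub_borelConstantTerm_sphericalEisenstein_cm_three` + ★ (E-d) `K2E1HeightLineArchSmoothU3E` (the payer of `hφarchZ`)
import HarnessLib

/-!
# h413 ∕ Track B «K2-LIT», «MS-3» (σ1)₃+(σ2)₃ — `K2E1MaassSelbergPairingCMThree`: the pairing `Φ(z,z′) = ⟪Λ^T E(z′), Λ^T E(z)⟫_{L²(X)}` of the truncated spherical Eisenstein series of
# `U(2,1)∕CM` is holomorphic × antiholomorphic on the tube `{Re > 2}²`, is `‖Λ^T E(z)‖² ≥ 0` on the diagonal, and is the left side of the Maass–Selberg relation (R6k)₃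

Cell `pub/hodgecm-mathlib`, crux H413 = `stmt-HodgeConjecture-24833`, route `HCCMUnconditional`; dealer K2E1-plan (g6) DEAL (40) 10:06:38Z «PAIRING SUPPLIER N = 3, TUBE HALF» = the
`N = 3` twin of ★ p859225 (census of record 10:01:05Z; `(σ₀, ρ₀) = (2, 2)`, tube `{2 < Re}`, sub-tube `2 < Re z′ < Re z`; consumer ★ p859140 `poleControl_continued_cm_three_of_pairing[_lower]`,
binders `hΦ₁ hΦ₂ hrel hQ`).  THIS FILE = §1, the CONVERGENT-TUBE HALF (letter-free); §2 (the continued half on `D± = {Re > 1, Im ≷ 0}`, for the CONTINUED `Ẽ` of the closer₃) follows the closer₃.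
THEOREMS ONLY (no `def`, no `instance`, no `notation`, no named-fact hypothesis, no `sorry`; default heartbeats); lane `--kind proof --supports stmt-HodgeConjecture-24833 --as helper` (count-neutral).
THE MATHEMATICS ([MoeglinWaldspurger1995, IV.2.3–IV.3.12]; [Arthur1980TraceFormulaII, §4]; [BernsteinLapid2019, §4 Claim 5]).  Let `F : ℂ ⊃ U → L²(X, μ)` be HOLOMORPHIC (Fréchet, as a map into the
Hilbert space).  Then `Φ(z,z′) := ⟪F z′, F z⟫` is holomorphic in `z`, `w ↦ Φ(z, conj w)` is holomorphic on `conj⁻¹U`, and `Φ(z,z) = ‖F z‖² ≥ 0` (★ §A `pairing_of_differentiableOn`, imported).  For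
the truncated spherical Eisenstein series `F z := [x ↦ Λ^T E(φ₀H^z)(x)] ∈ L²(X, μ)` of `U(2,1)∕CM` on Godement's tube `U = {Re z > 2}` (`2ρ_H = 2` at `N = 3`), holomorphy of `F` is ★
`differentiableOn_of_weighted_bound` (a DOMINATED pointwise-holomorphic family is `L²`-holomorphic) fed by: (i) pointwise holomorphy of `z ↦ Λ^T E(φ₀H^z)(g)` (§B: `Λ^T = 1 − Ψ ∘ c_B^T`; ★
holomorphy of `z ↦ E(φ₀H^z)(g)` on `{Re > 2}`; the cut-off pseudo-Eisenstein sum has `z`-FREE subsingleton support for `T ≥ 1` (★ `siegel_three`), and each constant term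
`E_B(z)(h) = (ν𝓕)⁻¹∫_𝓕 E(z)(uh)dν` over the relatively compact fundamental domain `𝓕 ⊂ N(𝔸)` of the Heisenberg radical is holomorphic by dominated differentiation, ★
`differentiableOn_integral_of_dominated` with ★ joint continuity of `(z,g) ↦ E(z)(g)`), (ii) the locally uniform sup bound ★ `exists_nhds_norm_truncation_eisensteinSeriesU_flatSectionU_le_cm_three`
with the cusp decay ★ (R3u)₃-sph `exists_bound_sub_borelConstantTerm_sphericalEisenstein_cm_three`, whose displayed archimedean binder `hφarchZ` is ★ PAID by (E-d)
`exists_archSmoothZ_flatSectionU_const_cm_three_uniform` — so the decay is UNCONDITIONAL at `N = 3` as well (§C `exists_bound_sub_borelConstantTerm_sphericalEisenstein_cm_three_free`: every letter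
chosen inside — `c² = 1`, a trace-zero `δ ∈ L⁻ ∖ 0`, the Borel structure and an additive Haar measure on `𝔸_{L⁺}`, the archimedean order `m = [L:ℚ] + 1`), (iii) measurability∕`L²` ★
`memLp_quotFun_truncation_eisensteinSeriesU_flatSectionU_cm_three` (§C).  Finally (§D) on the tube `hΦ₁ hΦ₂ hQ` are §A, and `hrel` (raw form) identifies `⟪F z′, F z⟫ = ∫_X Λ^TE(z)·conj Λ^TE(z′) dμ`
with the LEFT SIDE of ★ (R6k)₃ `maassSelberg_flatSectionU_cm_three_final_const` VERBATIM, so that ★ (R6k)₃ (survivor `hdec′` paid by §C) turns it into the four-term `R(z,z′;c)` on the sub-tube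
`2 < Re z′ < Re z`.
* §B `differentiableOn_borelConstantTerm_eisensteinSeriesU_flatSectionU_cm_three`, `differentiableOn_truncation_eisensteinSeriesU_flatSectionU_apply_cm_three` (pointwise holomorphy in `z` on `{Re > 2}`).
* §C `exists_bound_sub_borelConstantTerm_sphericalEisenstein_cm_three_free` (the (R3u)₃-sph cusp bound with EVERY letter discharged), **`exists_toLp_truncation_differentiableOn_cm_three`** — the
  `L²(X, μ)`-valued truncated spherical Eisenstein family of `U(2,1)∕CM` is HOLOMORPHIC on `{Re z > 2}`.
* §D HEAD **`pairing_tube_cm_three`** — `∃ F`, representing `Λ^T E(φ₀H^z)` in `L²`, with `hΦ₁ hΦ₂ hQ` on `{Re > 2}` and `hrel` (raw form) on the tube for `Φ z z′ := ⟪F z′, F z⟫`, letter-free.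
* §E **`pairing_tube_fourTerm_cm_three`** — the same with `hrel` in the FOUR-TERM currency of ★ (R6k)₃ on the sub-tube `2 < Re z′ < Re z` (in (R6k)₃'s data `μ, ν_G, μ_K, ν_I, 𝓕_I, ν, 𝓕, β`;
  survivor `hdec′` paid by §C, `[ν.IsInvInvariant]` by ★ `isInvInvariant_of_isHaarMeasure_adelicUnipotent_three`), letter-free.
HONEST LABEL.  Count-neutral helper; proves no printed statement; the tube half only (the continued half needs the closer₃'s pole ledger on `D±` and `L²` bounds of `Λ^TẼ`); HC_CM is proved
only modulo the 7 printed citations (2 remaining named inputs: hLiu418 = `stmt-HodgeConjecture-24832`, h413 = `stmt-HodgeConjecture-24833`) until rung 0 closes.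

## References
* [MoeglinWaldspurger1995] C. Mœglin, J.-L. Waldspurger, *Spectral decomposition and Eisenstein series* (1995), II.1.5–II.1.7 (constant terms), IV.2.3 (Maass–Selberg), IV.3.12 (continuation argument).
* [Arthur1980TraceFormulaII] J. Arthur, *A trace formula for reductive groups II*, Compositio Math. 40 (1980), §4.
* [BernsteinLapid2019] J. Bernstein, E. Lapid, *On the meromorphic continuation of Eisenstein series*, J. AMS 37 (2024), §4 (Claim 5: holomorphic families in `L²`).
* [Rudin1991] W. Rudin, *Functional Analysis* (1991), Thm. 3.31 (vector-valued holomorphy).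
* [Garrett2018] P. Garrett, *Modern Analysis of Automorphic Forms by Example* (2018), §2.10 (truncation and the cut-off pseudo-Eisenstein series).
-/

set_option autoImplicit false
set_option linter.dupNamespace false  -- the mandated namespace repeats the summit's segment (`HodgeConjecture.HodgeConjecture`)

noncomputable section

open MeasureTheory Measure NumberField IsDedekindDomain Set Filter Topology Metric MulAction
open scoped ENNReal NNReal ComplexConjugate InnerProductSpace
open Literature.MeasureTheory.Group Literature.NumberTheory.Automorphic Literature.NumberTheory.Automorphic.UnitaryGroup AdelicGroupData
open Literature.Analysis.Complex (differentiableOn_integral_of_dominated)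
open Summit.HodgeConjecture.HodgeConjecture.Cruxes.H413.K2E1BorelEisensteinU
open Summit.HodgeConjecture.HodgeConjecture.Cruxes.H413.K2E1BorelEisensteinRegularCMThree
open Summit.HodgeConjecture.HodgeConjecture.Cruxes.H413.K2E1TruncatedEisensteinExplicit
open Summit.HodgeConjecture.HodgeConjecture.Cruxes.H413.K2E1TruncatedEisensteinBoundedCMThree
open Summit.HodgeConjecture.HodgeConjecture.Cruxes.H413.K2E1TruncatedEisensteinLocallyUniformCMThree
open Summit.HodgeConjecture.HodgeConjecture.Cruxes.H413.K2E1BLHeightPowerHolomorphicU2 (differentiableOn_of_weighted_bound)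
open Summit.HodgeConjecture.HodgeConjecture.Cruxes.H413.K2E1MaassSelbergPoleControlSphericalCMThreeArch (exists_bound_sub_borelConstantTerm_sphericalEisenstein_cm_three)
open Summit.HodgeConjecture.HodgeConjecture.Cruxes.H413.K2E1HeightLineArchSmoothU3E (exists_archSmoothZ_flatSectionU_const_cm_three_uniform)
open Summit.HodgeConjecture.HodgeConjecture.Cruxes.H413.K2E1MaassSelbergPairingCMTwo (pairing_of_differentiableOn)
open Summit.HodgeConjecture.HodgeConjecture.Cruxes.H413.K2E1MaassSelbergSphericalBracketsCMThree (maassSelberg_flatSectionU_cm_three_final_const)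
open Summit.HodgeConjecture.HodgeConjecture.Cruxes.H413.K2E1HeisenbergHaarU3 (isInvInvariant_of_isHaarMeasure_adelicUnipotent_three)

namespace Summit.HodgeConjecture.HodgeConjecture.Cruxes.H413.K2E1MaassSelbergPairingCMThree

/-! ## §B Pointwise holomorphy in `z` of the constant term and of the truncation of `E(φ₀H^z)` on `U(2,1)∕CM` -/

section Pointwise

variable (L : Type) [Field L] [NumberField L] [IsCMField L]
variable [MeasurableSpace (adelicUnipotent (↥(maximalRealSubfield L)) L (IsCMField.complexConj L) 3)] [BorelSpace (adelicUnipotent (↥(maximalRealSubfield L)) L (IsCMField.complexConj L) 3)]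

/-- **`z ↦ E(φ, z)_B(h)` IS HOLOMORPHIC on `{Re z > 2}`** (`U(J₃)`) for every bounded continuous `φ` and every `h`: `E_B(h) = (ν𝓕)⁻¹ ∫_𝓕 E(z)(u h) dν(u)` over the relatively compact fundamental
domain `𝓕` of the Heisenberg radical (★ `borelConstantTerm_def`), differentiated under the integral sign (★ `differentiableOn_integral_of_dominated`) with the pointwise holomorphy ★
`differentiableOn_eisensteinSeriesU_flatSectionU_cm_three` and a constant majorant from the JOINT continuity ★ `continuous_eisensteinSeriesU_flatSectionU_uncurry_cm_three` on the compact
`closedBall z₀ r × (closure 𝓕)·h`. [cite: MoeglinWaldspurger1995, II.1.5–II.1.7] -/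
theorem differentiableOn_borelConstantTerm_eisensteinSeriesU_flatSectionU_cm_three
    (ν : Measure (adelicUnipotent (↥(maximalRealSubfield L)) L (IsCMField.complexConj L) 3)) [ν.IsHaarMeasure]
    {𝓕 : Set (adelicUnipotent (↥(maximalRealSubfield L)) L (IsCMField.complexConj L) 3)} (h𝓕m : NullMeasurableSet 𝓕 ν) (h𝓕c : IsCompact (closure 𝓕))
    {φ : (quasiSplit (↥(maximalRealSubfield L)) L (IsCMField.complexConj L) 3).Adelic → ℂ} (hφc : Continuous φ) {M : ℝ} (hφM : ∀ x, ‖φ x‖ ≤ M)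
    (h : (quasiSplit (↥(maximalRealSubfield L)) L (IsCMField.complexConj L) 3).Adelic) :
    DifferentiableOn ℂ (fun z : ℂ => borelConstantTerm ν 𝓕 (eisensteinSeriesU (flatSectionU φ z)) h) {z : ℂ | 2 < z.re} := by
  -- the parametric integral `z ↦ ∫_{u ∈ 𝓕} E(φ,z)(u h) dν`
  have hint : DifferentiableOn ℂ (fun z : ℂ => ∫ u in 𝓕, eisensteinSeriesU (flatSectionU φ z) ((u : (quasiSplit (↥(maximalRealSubfield L)) L (IsCMField.complexConj L) 3).Adelic) * h) ∂ν) {z : ℂ | 2 < z.re} := by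
    haveI : IsFiniteMeasure (ν.restrict 𝓕) := isFiniteMeasure_restrict.2 ((measure_mono subset_closure).trans_lt h𝓕c.measure_lt_top).ne
    refine differentiableOn_integral_of_dominated (μ := ν.restrict 𝓕) (fun z hz => ?_) (Eventually.of_forall fun u => ?_) fun z₀ hz₀ => ?_
    · exact ((continuous_eisensteinSeriesU_flatSectionU_cm_three L hz hφc hφM).comp (continuous_subtype_val.mul continuous_const)).aestronglyMeasurable
    · exact differentiableOn_eisensteinSeriesU_flatSectionU_cm_three L hφM _
    · -- a constant majorant on the ball `ball z₀ r`, `r = (Re z₀ − 2)∕2`, from joint continuity on the compact `closedBall z₀ r × (closure 𝓕)·h`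
      have hz₀' : 2 < z₀.re := hz₀
      set r : ℝ := (z₀.re - 2) / 2 with hr
      have hr0 : 0 < r := by rw [hr]; linarith
      have hballU : closedBall z₀ r ⊆ {z : ℂ | 2 < z.re} := fun z hz => by
        have h1 : |(z - z₀).re| ≤ r := (Complex.abs_re_le_norm (z - z₀)).trans (by rwa [mem_closedBall, dist_eq_norm] at hz)
        rw [Complex.sub_re] at h1
        show 2 < z.re
        rw [hr] at h1
        linarith [(abs_le.1 h1).1]
      have hKz : IsCompact (Subtype.val ⁻¹' closedBall z₀ r : Set {z : ℂ // (2 : ℝ) < z.re}) :=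
        Topology.IsEmbedding.subtypeVal.isCompact_iff.2 (by
          rw [Set.image_preimage_eq_inter_range, Subtype.range_coe_subtype, Set.inter_eq_left.2 (fun z hz => hballU hz)]
          exact isCompact_closedBall z₀ r)
      have hK : IsCompact ((Subtype.val ⁻¹' closedBall z₀ r : Set {z : ℂ // (2 : ℝ) < z.re}) ×ˢ
          ((fun u : ↥(adelicUnipotent (↥(maximalRealSubfield L)) L (IsCMField.complexConj L) 3) => (u : (quasiSplit (↥(maximalRealSubfield L)) L (IsCMField.complexConj L) 3).Adelic) * h) '' closure 𝓕)) :=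
        hKz.prod (h𝓕c.image (continuous_subtype_val.mul continuous_const))
      obtain ⟨C, hC⟩ := hK.exists_bound_of_continuousOn ((continuous_eisensteinSeriesU_flatSectionU_uncurry_cm_three L hφc hφM).continuousOn)
      refine ⟨r, hr0, ball_subset_closedBall.trans hballU, fun _ => C, integrable_const C, (ae_restrict_iff'₀ h𝓕m).2 (Eventually.of_forall fun u hu z hz => ?_)⟩
      have hz1 : (2 : ℝ) < z.re := hballU (ball_subset_closedBall hz)
      exact hC ⟨⟨z, hz1⟩, (u : (quasiSplit (↥(maximalRealSubfield L)) L (IsCMField.complexConj L) 3).Adelic) * h⟩ ⟨show (z : ℂ) ∈ closedBall z₀ r from ball_subset_closedBall hz, Set.mem_image_of_mem _ (subset_closure hu)⟩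
  have hfun : (fun z : ℂ => borelConstantTerm ν 𝓕 (eisensteinSeriesU (flatSectionU φ z)) h) =
      fun z : ℂ => ((ν 𝓕).toReal⁻¹ : ℝ) • ∫ u in 𝓕, eisensteinSeriesU (flatSectionU φ z) ((u : (quasiSplit (↥(maximalRealSubfield L)) L (IsCMField.complexConj L) 3).Adelic) * h) ∂ν :=
    funext fun z => borelConstantTerm_def ν 𝓕 _ h
  rw [hfun]
  exact hint.const_smul ((ν 𝓕).toReal⁻¹ : ℝ)

/-- **`z ↦ Λ^T E(φ, z)(g)` IS HOLOMORPHIC on `{Re z > 2}`** (`U(J₃)`) for `T ≥ 1`, every bounded continuous `φ` and every `g`: `Λ^T E = E − Ψ(c_B^T E)` (★ `truncation_def`), where for `T ≥ 1` the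
cut-off pseudo-Eisenstein sum `Ψ(c_B^T E(z))(g) = ∑_{δ : H(δg) > T} E(z)_B(δg)` runs over a `z`-FREE subsingleton set of cosets (★ `subsingleton_setOf_lt_borelHeight_out_mul` with ★ `siegel_three`:
`F`-rank one), each term holomorphic by `differentiableOn_borelConstantTerm_eisensteinSeriesU_flatSectionU_cm_three`. [cite: MoeglinWaldspurger1995, I.2.13, II.1.5] [cite: Garrett2018, §2.10] -/
theorem differentiableOn_truncation_eisensteinSeriesU_flatSectionU_apply_cm_three
    (ν : Measure (adelicUnipotent (↥(maximalRealSubfield L)) L (IsCMField.complexConj L) 3)) [ν.IsHaarMeasure]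
    {𝓕 : Set (adelicUnipotent (↥(maximalRealSubfield L)) L (IsCMField.complexConj L) 3)} (h𝓕m : NullMeasurableSet 𝓕 ν) (h𝓕c : IsCompact (closure 𝓕))
    {T : ℝ≥0} (hT : 1 ≤ T) {φ : (quasiSplit (↥(maximalRealSubfield L)) L (IsCMField.complexConj L) 3).Adelic → ℂ} (hφc : Continuous φ) {M : ℝ} (hφM : ∀ x, ‖φ x‖ ≤ M)
    (g : (quasiSplit (↥(maximalRealSubfield L)) L (IsCMField.complexConj L) 3).Adelic) :
    DifferentiableOn ℂ (fun z : ℂ => truncation ν 𝓕 T (eisensteinSeriesU (flatSectionU φ z)) g) {z : ℂ | 2 < z.re} := by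
  -- the `z`-free finite set of high cosets
  have hfin : ({q : Quotient (QuotientGroup.rightRel (arithmeticBorel (↥(maximalRealSubfield L)) L (IsCMField.complexConj L) 3)) |
      T < borelHeight (((q.out : (quasiSplit (↥(maximalRealSubfield L)) L (IsCMField.complexConj L) 3).arithmeticSubgroup) : (quasiSplit (↥(maximalRealSubfield L)) L (IsCMField.complexConj L) 3).Adelic) * g)}).Finite :=
    (subsingleton_setOf_lt_borelHeight_out_mul siegel_three hT g).finite
  have hΨ : ∀ z : ℂ, pseudoEisenstein (constantTermTail ν 𝓕 T (eisensteinSeriesU (flatSectionU φ z))) g =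
      ∑ q ∈ hfin.toFinset, Set.indicator {x : (quasiSplit (↥(maximalRealSubfield L)) L (IsCMField.complexConj L) 3).Adelic | T < borelHeight x} (borelConstantTerm ν 𝓕 (eisensteinSeriesU (flatSectionU φ z)))
        (((q.out : (quasiSplit (↥(maximalRealSubfield L)) L (IsCMField.complexConj L) 3).arithmeticSubgroup) : (quasiSplit (↥(maximalRealSubfield L)) L (IsCMField.complexConj L) 3).Adelic) * g) := by
    intro z
    rw [pseudoEisenstein_def]
    refine finsum_eq_sum_of_support_subset _ fun q hq => ?_
    rw [Set.Finite.coe_toFinset, Set.mem_setOf_eq]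
    by_contra hnot
    simp only [Function.mem_support, ne_eq] at hq
    exact hq (Set.indicator_of_notMem (show ((q.out : (quasiSplit (↥(maximalRealSubfield L)) L (IsCMField.complexConj L) 3).arithmeticSubgroup) : (quasiSplit (↥(maximalRealSubfield L)) L (IsCMField.complexConj L) 3).Adelic) * g ∉ {x : (quasiSplit (↥(maximalRealSubfield L)) L (IsCMField.complexConj L) 3).Adelic | T < borelHeight x} from hnot) _)
  have hfun : (fun z : ℂ => truncation ν 𝓕 T (eisensteinSeriesU (flatSectionU φ z)) g) = fun z : ℂ => eisensteinSeriesU (flatSectionU φ z) g -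
      ∑ q ∈ hfin.toFinset, Set.indicator {x : (quasiSplit (↥(maximalRealSubfield L)) L (IsCMField.complexConj L) 3).Adelic | T < borelHeight x} (borelConstantTerm ν 𝓕 (eisensteinSeriesU (flatSectionU φ z)))
        (((q.out : (quasiSplit (↥(maximalRealSubfield L)) L (IsCMField.complexConj L) 3).arithmeticSubgroup) : (quasiSplit (↥(maximalRealSubfield L)) L (IsCMField.complexConj L) 3).Adelic) * g) := by
    funext z
    rw [truncation_def, hΨ z]
  rw [hfun]
  refine (differentiableOn_eisensteinSeriesU_flatSectionU_cm_three L hφM g).sub (DifferentiableOn.fun_sum fun q _ => ?_)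
  by_cases hq : T < borelHeight (((q.out : (quasiSplit (↥(maximalRealSubfield L)) L (IsCMField.complexConj L) 3).arithmeticSubgroup) : (quasiSplit (↥(maximalRealSubfield L)) L (IsCMField.complexConj L) 3).Adelic) * g)
  · simp only [Set.indicator_of_mem (show _ ∈ {x : (quasiSplit (↥(maximalRealSubfield L)) L (IsCMField.complexConj L) 3).Adelic | T < borelHeight x} from hq)]
    exact differentiableOn_borelConstantTerm_eisensteinSeriesU_flatSectionU_cm_three L ν h𝓕m h𝓕c hφc hφM _
  · simp only [Set.indicator_of_notMem (show _ ∉ {x : (quasiSplit (↥(maximalRealSubfield L)) L (IsCMField.complexConj L) 3).Adelic | T < borelHeight x} from hq)]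
    exact differentiableOn_const _

end Pointwise

/-! ## §C The (R3u)₃-sph cusp bound with every letter discharged; the `L²(X)`-valued truncated spherical Eisenstein family is holomorphic on the tube `{Re z > 2}` -/

section L2Family

variable (L : Type) [Field L] [NumberField L] [IsCMField L]
-- the Borel structure of `U(J₃)(𝔸_{L⁺})`; `N(𝔸)` carries the induced (subtype) Borel structure, as in ★ `exists_bound_sub_borelConstantTerm_sphericalEisenstein_cm_three`
variable [MeasurableSpace (quasiSplit (↥(maximalRealSubfield L)) L (IsCMField.complexConj L) 3).Adelic] [BorelSpace (quasiSplit (↥(maximalRealSubfield L)) L (IsCMField.complexConj L) 3).Adelic]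

/-- **THE SPHERICAL CUSP BOUND OF `U(2,1)∕CM`, EVERY LETTER DISCHARGED**: for `T ≥ 1`, `φ₀ ∈ ℂ`, a Haar measure `ν` on `N(𝔸)` with a relatively compact fundamental domain `𝓕` for `N(L⁺)`,
and a compact `Kc ⊂ {Re > 2}`: `∃ M₁, ∀ w ∈ Kc, ∀ g, T < H g → ‖E(φ₀H^w)(g) − E(φ₀H^w)_B(g)‖ ≤ M₁`.  This is ★ (R3u)₃-sph `exists_bound_sub_borelConstantTerm_sphericalEisenstein_cm_three`
with its displayed letters CHOSEN HERE — `c² = 1` (★ `complexConj_apply_apply`), a trace-zero `δ ∈ L⁻ ∖ 0` (exists since `c ≠ 1`), the Borel structure and the additive Haar measure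
`addHaar` on `𝔸_{L⁺}`, the archimedean order `m = [L:ℚ] + 1`, the radius `R = sup_{Kc} ‖w‖` — and its archimedean binder `hφarchZ` PAID by ★ (E-d)
`exists_archSmoothZ_flatSectionU_const_cm_three_uniform` (call pattern of ★ `K2E1EisensteinCompactRangeMajorantCMThree`). [cite: MoeglinWaldspurger1995, II.1.7, IV.2.3] [cite: Arthur1980TraceFormulaII, §4] -/
theorem exists_bound_sub_borelConstantTerm_sphericalEisenstein_cm_three_free
    (ν : Measure (adelicUnipotent (↥(maximalRealSubfield L)) L (IsCMField.complexConj L) 3)) [ν.IsHaarMeasure]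
    {𝓕 : Set (adelicUnipotent (↥(maximalRealSubfield L)) L (IsCMField.complexConj L) 3)}
    (h𝓕 : IsFundamentalDomain (rationalUnipotent (↥(maximalRealSubfield L)) L (IsCMField.complexConj L) 3) 𝓕 ν) (h𝓕c : IsCompact (closure 𝓕))
    {T : ℝ≥0} (hT : 1 ≤ T) (φ₀ : ℂ) {Kc : Set ℂ} (hKc : IsCompact Kc) (hKc2 : ∀ w ∈ Kc, 2 < w.re) :
    ∃ M₁ : ℝ, ∀ w ∈ Kc, ∀ g : (quasiSplit (↥(maximalRealSubfield L)) L (IsCMField.complexConj L) 3).Adelic, T < borelHeight g →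
      ‖eisensteinSeriesU (flatSectionU (fun _ : (quasiSplit (↥(maximalRealSubfield L)) L (IsCMField.complexConj L) 3).Adelic => φ₀) w) g -
        borelConstantTerm ν 𝓕 (eisensteinSeriesU (flatSectionU (fun _ : (quasiSplit (↥(maximalRealSubfield L)) L (IsCMField.complexConj L) 3).Adelic => φ₀) w)) g‖ ≤ M₁ := by
  -- the letters of ★ (R3u)₃-sph, chosen here
  have hc : IsCMField.complexConj L * IsCMField.complexConj L = 1 :=
    AlgEquiv.ext fun y => by rw [AlgEquiv.mul_apply, AlgEquiv.one_apply, IsCMField.complexConj_apply_apply]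
  obtain ⟨δ, hδ, hcδ⟩ : ∃ δ : L, δ ≠ 0 ∧ IsCMField.complexConj L δ = -δ := by
    obtain ⟨x, hx⟩ : ∃ x : L, IsCMField.complexConj L x ≠ x := by
      by_contra h
      exact IsCMField.complexConj_ne_one (K := L) (AlgEquiv.ext fun x => not_not.1 fun hx => h ⟨x, hx⟩)
    exact ⟨x - IsCMField.complexConj L x, sub_ne_zero.2 (Ne.symm hx), by rw [map_sub, IsCMField.complexConj_apply_apply, neg_sub]⟩
  letI : MeasurableSpace (AdeleRing (𝓞 ↥(maximalRealSubfield L)) ↥(maximalRealSubfield L)) := borel _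
  haveI : BorelSpace (AdeleRing (𝓞 ↥(maximalRealSubfield L)) ↥(maximalRealSubfield L)) := ⟨rfl⟩
  haveI := locallyCompactSpace_adeleRing' ↥(maximalRealSubfield L)
  -- the radius `R` with `‖w‖ ≤ R` on the compact `Kc`
  obtain ⟨R, hR⟩ := hKc.exists_bound_of_continuousOn (f := fun w : ℂ => w) continuous_id.continuousOn
  exact exists_bound_sub_borelConstantTerm_sphericalEisenstein_cm_three L hc hcδ hδ ν h𝓕 h𝓕c
    (Measure.addHaar : Measure (AdeleRing (𝓞 ↥(maximalRealSubfield L)) ↥(maximalRealSubfield L))) (m := Module.finrank ℚ L + 1) (by exact_mod_cast Nat.lt_succ_self _) hT φ₀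
    (fun R' => exists_archSmoothZ_flatSectionU_const_cm_three_uniform L hc hcδ hδ
      (Measure.addHaar : Measure (AdeleRing (𝓞 ↥(maximalRealSubfield L)) ↥(maximalRealSubfield L))) φ₀ (Module.finrank ℚ L + 1) R')
    hKc hKc2 (R := R) (fun w hw => hR w hw)

/-- **THE TRUNCATED SPHERICAL EISENSTEIN SERIES OF `U(2,1)∕CM` IS AN `L²(X)`-HOLOMORPHIC FAMILY ON `{Re z > 2}`.**  For `T ≥ 1`, `φ₀ ∈ ℂ`, a Haar measure `ν` on `N(𝔸)` with a relatively compact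
fundamental domain `𝓕` for `N(L⁺)`, and any finite measure `μ` on the automorphic quotient `X` of `U(2,1)_{L∕L⁺}`: there is `F : ℂ → L²(X, μ)` with `F z = [Λ^T E(φ₀H^z)]` a.e. for `Re z > 2` and `F`
complex differentiable (as an `L²`-valued map) on `{Re z > 2}` — ★ `differentiableOn_of_weighted_bound` (`W = 1`) on a neighbourhood of each point, fed by §B (pointwise holomorphy), the locally
uniform sup bound ★ `exists_nhds_norm_truncation_eisensteinSeriesU_flatSectionU_le_cm_three` with the UNCONDITIONAL decay `exists_bound_sub_borelConstantTerm_sphericalEisenstein_cm_three_free`, and ★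
`memLp_quotFun_truncation_eisensteinSeriesU_flatSectionU_cm_three`. [cite: BernsteinLapid2019, §4 Claim 5] [cite: MoeglinWaldspurger1995, IV.2.3, IV.3.12] [cite: Rudin1991, Thm. 3.31] -/
theorem exists_toLp_truncation_differentiableOn_cm_three
    (ν : Measure (adelicUnipotent (↥(maximalRealSubfield L)) L (IsCMField.complexConj L) 3)) [ν.IsHaarMeasure]
    {𝓕 : Set (adelicUnipotent (↥(maximalRealSubfield L)) L (IsCMField.complexConj L) 3)}
    (h𝓕 : IsFundamentalDomain (rationalUnipotent (↥(maximalRealSubfield L)) L (IsCMField.complexConj L) 3) 𝓕 ν) (h𝓕c : IsCompact (closure 𝓕))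
    {T : ℝ≥0} (hT : 1 ≤ T) (φ₀ : ℂ) (μ : Measure (quasiSplit (↥(maximalRealSubfield L)) L (IsCMField.complexConj L) 3).automorphicQuotient) [IsFiniteMeasure μ] :
    ∃ F : ℂ → Lp ℂ 2 μ, DifferentiableOn ℂ F {z : ℂ | 2 < z.re} ∧
      ∀ z : ℂ, 2 < z.re → ((F z : Lp ℂ 2 μ) : (quasiSplit (↥(maximalRealSubfield L)) L (IsCMField.complexConj L) 3).automorphicQuotient → ℂ) =ᵐ[μ] (quasiSplit (↥(maximalRealSubfield L)) L (IsCMField.complexConj L) 3).quotFun (truncation ν 𝓕 T (eisensteinSeriesU (flatSectionU (fun _ : (quasiSplit (↥(maximalRealSubfield L)) L (IsCMField.complexConj L) 3).Adelic => φ₀) z))) := by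
  classical
  -- `L²` membership at each point of the tube (the decay at the singleton `{z}`)
  have hmem : ∀ z : ℂ, 2 < z.re → MemLp ((quasiSplit (↥(maximalRealSubfield L)) L (IsCMField.complexConj L) 3).quotFun (truncation ν 𝓕 T (eisensteinSeriesU (flatSectionU (fun _ : (quasiSplit (↥(maximalRealSubfield L)) L (IsCMField.complexConj L) 3).Adelic => φ₀) z)))) 2 μ := by
    intro z hz
    obtain ⟨M₁, hM₁⟩ := exists_bound_sub_borelConstantTerm_sphericalEisenstein_cm_three_free L ν h𝓕 h𝓕c hT φ₀ (isCompact_singleton (x := z))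
      (fun w hw => by rw [Set.mem_singleton_iff.1 hw]; exact hz)
    exact memLp_quotFun_truncation_eisensteinSeriesU_flatSectionU_cm_three L ν h𝓕 hT hz continuous_const (M := ‖φ₀‖) (fun _ => le_rfl) (fun _ _ _ => rfl)
      (hM₁ z (Set.mem_singleton z)) μ 2
  -- the family
  refine ⟨fun z => if h : MemLp ((quasiSplit (↥(maximalRealSubfield L)) L (IsCMField.complexConj L) 3).quotFun (truncation ν 𝓕 T (eisensteinSeriesU (flatSectionU (fun _ : (quasiSplit (↥(maximalRealSubfield L)) L (IsCMField.complexConj L) 3).Adelic => φ₀) z)))) 2 μ then h.toLp _ else 0, ?_, fun z hz => ?_⟩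
  swap
  · dsimp only
    rw [dif_pos (hmem z hz)]
    exact MemLp.coeFn_toLp _
  intro z₀ hz₀
  have hz₀' : 2 < z₀.re := hz₀
  -- a compact neighbourhood `V ⊆ {Re > 2}` of `z₀` with ONE sup bound for `Λ^T E(φ₀H^z)`, `z ∈ V`
  obtain ⟨V, hV, hVc, hV2, hbd⟩ := exists_nhds_norm_truncation_eisensteinSeriesU_flatSectionU_le_cm_three L ν h𝓕 hT hz₀' continuous_const (M := ‖φ₀‖) (fun _ => le_rfl) (fun _ _ _ => rfl)
  obtain ⟨M₁, hM₁⟩ := exists_bound_sub_borelConstantTerm_sphericalEisenstein_cm_three_free L ν h𝓕 h𝓕c hT φ₀ hVc hV2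
  obtain ⟨M₀, hM₀⟩ := hbd hM₁
  have h0V : z₀ ∈ interior V := mem_interior_iff_mem_nhds.2 hV
  have hIV : interior V ⊆ {z : ℂ | 2 < z.re} := fun z hz => hV2 z (interior_subset hz)
  have hdiffV : DifferentiableOn ℂ (fun z => if h : MemLp ((quasiSplit (↥(maximalRealSubfield L)) L (IsCMField.complexConj L) 3).quotFun (truncation ν 𝓕 T (eisensteinSeriesU (flatSectionU (fun _ : (quasiSplit (↥(maximalRealSubfield L)) L (IsCMField.complexConj L) 3).Adelic => φ₀) z)))) 2 μ then h.toLp _ else 0) (interior V) := by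
    refine differentiableOn_of_weighted_bound (μ := μ) (f := fun z => (quasiSplit (↥(maximalRealSubfield L)) L (IsCMField.complexConj L) 3).quotFun (truncation ν 𝓕 T (eisensteinSeriesU (flatSectionU (fun _ : (quasiSplit (↥(maximalRealSubfield L)) L (IsCMField.complexConj L) 3).Adelic => φ₀) z)))) isOpen_interior (fun x => ?_) (fun s hs => (hmem s (hIV hs)).1)
      (W := fun _ => (1 : ℝ)) (memLp_const 1) (C := max (max M₀ M₁) 0) (le_max_right _ _) (fun s hs x => ?_) (fun s hs => ?_)
    · exact (differentiableOn_truncation_eisensteinSeriesU_flatSectionU_apply_cm_three L ν h𝓕.nullMeasurableSet h𝓕c hT continuous_const (M := ‖φ₀‖) (fun _ => le_rfl) _).mono hIV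
    · rw [mul_one]
      exact (AdelicGroupData.norm_quotFun_le (hM₀ s (interior_subset hs)) x).trans (le_max_left _ _)
    · show (((if h : MemLp ((quasiSplit (↥(maximalRealSubfield L)) L (IsCMField.complexConj L) 3).quotFun (truncation ν 𝓕 T (eisensteinSeriesU (flatSectionU (fun _ : (quasiSplit (↥(maximalRealSubfield L)) L (IsCMField.complexConj L) 3).Adelic => φ₀) s)))) 2 μ then h.toLp _ else 0 : Lp ℂ 2 μ)) : (quasiSplit (↥(maximalRealSubfield L)) L (IsCMField.complexConj L) 3).automorphicQuotient → ℂ) =ᵐ[μ] (quasiSplit (↥(maximalRealSubfield L)) L (IsCMField.complexConj L) 3).quotFun (truncation ν 𝓕 T (eisensteinSeriesU (flatSectionU (fun _ : (quasiSplit (↥(maximalRealSubfield L)) L (IsCMField.complexConj L) 3).Adelic => φ₀) s)))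
      rw [dif_pos (hmem s (hIV hs))]
      exact MemLp.coeFn_toLp _
  exact ((hdiffV z₀ h0V).differentiableAt (isOpen_interior.mem_nhds h0V)).differentiableWithinAt

end L2Family

/-! ## §D HEAD: the pairing on the tube — `hΦ₁`, `hΦ₂`, `hQ` on `{Re > 2}`, and the inner product as the Maass–Selberg left side -/

section Tube

variable (L : Type) [Field L] [NumberField L] [IsCMField L]
-- the Borel structure of `U(J₃)(𝔸_{L⁺})`; `N(𝔸)` carries the induced (subtype) Borel structure, as in ★ `exists_bound_sub_borelConstantTerm_sphericalEisenstein_cm_three`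
variable [MeasurableSpace (quasiSplit (↥(maximalRealSubfield L)) L (IsCMField.complexConj L) 3).Adelic] [BorelSpace (quasiSplit (↥(maximalRealSubfield L)) L (IsCMField.complexConj L) 3).Adelic]

/-- **HEAD — THE PAIRING SUPPLIER ON THE TUBE (`N = 3`).**  For `T ≥ 1`, `φ₀`, `ν`, `𝓕` as in §C and any finite measure `μ` on the automorphic quotient `X` of `U(2,1)_{L∕L⁺}` there is an
`L²(X,μ)`-valued family `F` with `F z = [Λ^T E(φ₀H^z)]` a.e. (`Re z > 2`) such that the pairing `Φ z z′ := ⟪F z′, F z⟫` satisfies, on `U = {Re > 2}`: (`hΦ₁`) `z ↦ Φ z z′` holomorphic on `U`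
(`z′ ∈ U`); (`hΦ₂`) `w ↦ Φ z (conj w)` holomorphic on `{Re w > 2} = conj⁻¹U` (`z ∈ U`); (`hQ`) `Φ z z = ‖F z‖² ≥ 0`; and (`hrel`, raw form) `Φ z z′ = ∫_X Λ^TE(z)·conj Λ^TE(z′) dμ` — the LEFT SIDE of
★ (R6k)₃ `maassSelberg_flatSectionU_cm_three_final_const` VERBATIM, so that ★ (R6k)₃ (with its survivor `hdec′` paid by §C `exists_bound_sub_borelConstantTerm_sphericalEisenstein_cm_three_free`) turns it
into the four-term `R(z,z′;c)` on the sub-tube `2 < Re z′ < Re z`.  These are the four binders of ★ `poleControl_continued_cm_three_of_pairing` RESTRICTED TO THE TUBE; the continued half (`1 < Re ≤ 2`,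
`Im ≷ 0`) takes the same §A with the continued family. [cite: MoeglinWaldspurger1995, IV.2.3, IV.3.12] [cite: Arthur1980TraceFormulaII, §4] [cite: BernsteinLapid2019, §4 Claim 5] -/
theorem pairing_tube_cm_three
    (ν : Measure (adelicUnipotent (↥(maximalRealSubfield L)) L (IsCMField.complexConj L) 3)) [ν.IsHaarMeasure]
    {𝓕 : Set (adelicUnipotent (↥(maximalRealSubfield L)) L (IsCMField.complexConj L) 3)}
    (h𝓕 : IsFundamentalDomain (rationalUnipotent (↥(maximalRealSubfield L)) L (IsCMField.complexConj L) 3) 𝓕 ν) (h𝓕c : IsCompact (closure 𝓕))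
    {T : ℝ≥0} (hT : 1 ≤ T) (φ₀ : ℂ) (μ : Measure (quasiSplit (↥(maximalRealSubfield L)) L (IsCMField.complexConj L) 3).automorphicQuotient) [IsFiniteMeasure μ] :
    ∃ F : ℂ → Lp ℂ 2 μ,
      (∀ z : ℂ, 2 < z.re → ((F z : Lp ℂ 2 μ) : (quasiSplit (↥(maximalRealSubfield L)) L (IsCMField.complexConj L) 3).automorphicQuotient → ℂ) =ᵐ[μ] (quasiSplit (↥(maximalRealSubfield L)) L (IsCMField.complexConj L) 3).quotFun (truncation ν 𝓕 T (eisensteinSeriesU (flatSectionU (fun _ : (quasiSplit (↥(maximalRealSubfield L)) L (IsCMField.complexConj L) 3).Adelic => φ₀) z)))) ∧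
      (∀ z' ∈ {z : ℂ | 2 < z.re}, DifferentiableOn ℂ (fun z : ℂ => ⟪F z', F z⟫_ℂ) {z : ℂ | 2 < z.re}) ∧
      (∀ z ∈ {z : ℂ | 2 < z.re}, DifferentiableOn ℂ (fun w : ℂ => ⟪F (conj w), F z⟫_ℂ) {w : ℂ | 2 < w.re}) ∧
      (∀ z ∈ {z : ℂ | 2 < z.re}, 0 ≤ ‖F z‖ ^ 2 ∧ ⟪F z, F z⟫_ℂ = (((‖F z‖ ^ 2 : ℝ)) : ℂ)) ∧
      (∀ z z' : ℂ, 2 < z.re → 2 < z'.re →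
        ⟪F z', F z⟫_ℂ = ∫ x, (quasiSplit (↥(maximalRealSubfield L)) L (IsCMField.complexConj L) 3).quotFun (truncation ν 𝓕 T (eisensteinSeriesU (flatSectionU (fun _ : (quasiSplit (↥(maximalRealSubfield L)) L (IsCMField.complexConj L) 3).Adelic => φ₀) z))) x * conj ((quasiSplit (↥(maximalRealSubfield L)) L (IsCMField.complexConj L) 3).quotFun (truncation ν 𝓕 T (eisensteinSeriesU (flatSectionU (fun _ : (quasiSplit (↥(maximalRealSubfield L)) L (IsCMField.complexConj L) 3).Adelic => φ₀) z'))) x) ∂μ) := by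
  obtain ⟨F, hFd, hF⟩ := exists_toLp_truncation_differentiableOn_cm_three L ν h𝓕 h𝓕c hT φ₀ μ
  obtain ⟨h₁, h₂, h₃⟩ := pairing_of_differentiableOn (isOpen_lt continuous_const Complex.continuous_re) hFd
  have hconj : {w : ℂ | conj w ∈ {z : ℂ | 2 < z.re}} = {w : ℂ | 2 < w.re} := by
    ext w; simp only [Set.mem_setOf_eq, Complex.conj_re]
  refine ⟨F, hF, h₁, fun z hz => hconj ▸ h₂ z hz, h₃, fun z z' hz hz' => ?_⟩
  rw [MeasureTheory.L2.inner_def]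
  refine integral_congr_ae ?_
  filter_upwards [hF z hz, hF z' hz'] with x hx hx'
  rw [hx, hx', RCLike.inner_apply, mul_comm]

end Tube

/-! ## §E `hrel` in the FOUR-TERM currency of (R6k)₃ on the sub-tube `2 < Re z′ < Re z`, letter-free -/

section FourTerm

variable (L : Type) [Field L] [NumberField L] [IsCMField L]
variable [MeasurableSpace (quasiSplit (↥(maximalRealSubfield L)) L (IsCMField.complexConj L) 3).Adelic] [BorelSpace (quasiSplit (↥(maximalRealSubfield L)) L (IsCMField.complexConj L) 3).Adelic]
variable [MeasurableSpace (AdeleRing (𝓞 L) L)ˣ] [BorelSpace (AdeleRing (𝓞 L) L)ˣ]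

/-- **THE PAIRING SUPPLIER ON THE TUBE WITH `hrel` IN MAASS–SELBERG FORM (`N = 3`).**  In the data of ★ (R6k)₃ `maassSelberg_flatSectionU_cm_three_final_const` — an automorphic measure `μ` on `X`,
a Haar measure `ν_G` (inversion-invariant), a Haar measure `μ_K` on `K_U`, a Haar measure `ν_I` on the ideles with an idele-class domain `𝓕_I`, a Haar measure `ν` on `N(𝔸)` with a relatively compact
fundamental domain `𝓕` of `N(L⁺)` of measure `1`, a covering weight `β` of `B(L⁺)♯` — and for `T ≥ 1`, `φ₀ ∈ ℂ`: there are the (R6k)₃ constants `cμ, K > 0` and an `L²(X,μ)`-valued family `F` with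
`F z = [Λ^T E(φ₀H^z)]` a.e. (`Re z > 2`), `hΦ₁ hΦ₂ hQ` on `{Re > 2}` (§D), and (`hrel`) on the sub-tube `2 < Re z′ < Re z`: **`⟪F z′, F z⟫ = cμ·K·R(z, z′; c_ν)`**, the FOUR-TERM right side of ★ (R6k)₃
VERBATIM at `φ₀′ = φ₀` (`c_ν(w) = ∫_{N(𝔸)} H(w₀v)^w dν`).  Proof: §D raw `hrel` ∘ ★ (R6k)₃, whose only survivor `hdec′` is PAID by §C `exists_bound_sub_borelConstantTerm_sphericalEisenstein_cm_three_free`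
(`Kc = {z′}`) and whose instance `[ν.IsInvInvariant]` is ★ `isInvInvariant_of_isHaarMeasure_adelicUnipotent_three` (the Heisenberg radical is unimodular).  These are the tube-half binders of ★
`poleControl_continued_cm_three_of_pairing` with `hrel` already in its currency. [cite: MoeglinWaldspurger1995, II.1.6–II.1.7, IV.2.3, IV.3.12] [cite: Arthur1980TraceFormulaII, §4] -/
theorem pairing_tube_fourTerm_cm_three
    (μ : Measure (quasiSplit (↥(maximalRealSubfield L)) L (IsCMField.complexConj L) 3).automorphicQuotient) [(quasiSplit (↥(maximalRealSubfield L)) L (IsCMField.complexConj L) 3).IsAutomorphicMeasure μ]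
    (νG : Measure (quasiSplit (↥(maximalRealSubfield L)) L (IsCMField.complexConj L) 3).Adelic) [νG.IsHaarMeasure] [νG.IsInvInvariant]
    (μK : Measure ((standardMaximalCompactGL 3 L).comap (adelicVal (↥(maximalRealSubfield L)) L (IsCMField.complexConj L) 3 ((StdForm.antidiagonal 3).over L)) : Subgroup (quasiSplit (↥(maximalRealSubfield L)) L (IsCMField.complexConj L) 3).Adelic))
    [μK.IsHaarMeasure]
    (νI : Measure (AdeleRing (𝓞 L) L)ˣ) [νI.IsHaarMeasure]
    {𝓕I : Set (AdeleRing (𝓞 L) L)ˣ} (h𝓕I : IsIdeleClassDomain L 𝓕I)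
    (ν : Measure ↥(adelicUnipotent (↥(maximalRealSubfield L)) L (IsCMField.complexConj L) 3)) [ν.IsHaarMeasure]
    {𝓕 : Set ↥(adelicUnipotent (↥(maximalRealSubfield L)) L (IsCMField.complexConj L) 3)} (h𝓕 : IsFundamentalDomain ↥(rationalUnipotent (↥(maximalRealSubfield L)) L (IsCMField.complexConj L) 3) 𝓕 ν) (h𝓕1 : ν 𝓕 = 1) (h𝓕c : IsCompact (closure 𝓕))
    {β : (quasiSplit (↥(maximalRealSubfield L)) L (IsCMField.complexConj L) 3).Adelic → ℝ≥0∞} (hβ : IsCoveringWeight ((arithmeticBorel (↥(maximalRealSubfield L)) L (IsCMField.complexConj L) 3).map (quasiSplit (↥(maximalRealSubfield L)) L (IsCMField.complexConj L) 3).arithmeticSubgroup.subtype) β)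
    {T : ℝ≥0} (hT : 1 ≤ T) (φ₀ : ℂ) :
    ∃ cμ K : ℝ, 0 < cμ ∧ 0 < K ∧ ∃ F : ℂ → Lp ℂ 2 μ,
      (∀ z : ℂ, 2 < z.re → ((F z : Lp ℂ 2 μ) : (quasiSplit (↥(maximalRealSubfield L)) L (IsCMField.complexConj L) 3).automorphicQuotient → ℂ) =ᵐ[μ] (quasiSplit (↥(maximalRealSubfield L)) L (IsCMField.complexConj L) 3).quotFun (truncation ν 𝓕 T (eisensteinSeriesU (flatSectionU (fun _ : (quasiSplit (↥(maximalRealSubfield L)) L (IsCMField.complexConj L) 3).Adelic => φ₀) z)))) ∧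
      (∀ z' ∈ {z : ℂ | 2 < z.re}, DifferentiableOn ℂ (fun z : ℂ => ⟪F z', F z⟫_ℂ) {z : ℂ | 2 < z.re}) ∧
      (∀ z ∈ {z : ℂ | 2 < z.re}, DifferentiableOn ℂ (fun w : ℂ => ⟪F (conj w), F z⟫_ℂ) {w : ℂ | 2 < w.re}) ∧
      (∀ z ∈ {z : ℂ | 2 < z.re}, 0 ≤ ‖F z‖ ^ 2 ∧ ⟪F z, F z⟫_ℂ = (((‖F z‖ ^ 2 : ℝ)) : ℂ)) ∧
      (∀ z z' : ℂ, 2 < z'.re → z'.re < z.re →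
        ⟪F z', F z⟫_ℂ =
          (cμ : ℂ) * ((K : ℂ) *
            ((((T : ℝ) : ℂ) ^ (z + conj z' - 2) / (z + conj z' - 2)) * ((∫ x in {x : (AdeleRing (𝓞 L) L)ˣ | (IdeleClassGroup.ideleNorm L x : ℝ) ≤ 1} ∩ 𝓕I, ((IdeleClassGroup.ideleNorm L x : ℝ) : ℂ) ∂νI) * (((μK.real Set.univ : ℝ) : ℂ) * (φ₀ * conj φ₀)))
              + (((T : ℝ) : ℂ) ^ (z - conj z') / (z - conj z')) * ((∫ x in {x : (AdeleRing (𝓞 L) L)ˣ | (IdeleClassGroup.ideleNorm L x : ℝ) ≤ 1} ∩ 𝓕I, ((IdeleClassGroup.ideleNorm L x : ℝ) : ℂ) ∂νI) * (((μK.real Set.univ : ℝ) : ℂ) * (φ₀ * conj ((∫ v : ↥(adelicUnipotent (↥(maximalRealSubfield L)) L (IsCMField.complexConj L) 3), (((borelHeight ((quasiSplit (↥(maximalRealSubfield L)) L (IsCMField.complexConj L) 3).toAdelic (weylLongU ((IsCMField.complexConj L : L ≃ₐ[↥(maximalRealSubfield L)] L) : L →+* L) (rfl : (StdForm.antidiagonal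 3).over L = (StdForm.antidiagonal 3).over L)) * (v : (quasiSplit (↥(maximalRealSubfield L)) L (IsCMField.complexConj L) 3).Adelic))) : ℝ) : ℂ) ^ z' ∂ν) * φ₀))))
              - (((T : ℝ) : ℂ) ^ (-(z - conj z')) / (z - conj z')) * ((∫ x in {x : (AdeleRing (𝓞 L) L)ˣ | (IdeleClassGroup.ideleNorm L x : ℝ) ≤ 1} ∩ 𝓕I, ((IdeleClassGroup.ideleNorm L x : ℝ) : ℂ) ∂νI) * (((μK.real Set.univ : ℝ) : ℂ) * ((∫ v : ↥(adelicUnipotent (↥(maximalRealSubfield L)) L (IsCMField.complexConj L) 3), (((borelHeight ((quasiSplit (↥(maximalRealSubfield L)) L (IsCMField.complexConj L) 3).toAdelic (weylLongU ((IsCMField.complexConj L : L ≃ₐ[↥(maximalRealSubfield L)] L) : L →+* L) (rfl : (StdForm.antidiagonal 3).over L = (StdForm.antidiagonal 3).over L)) * (v : (quasiSplit (↥(maximalRealSubfield L)) L (IsCMField.complexConj L) 3).Adelic))) : ℝ) : ℂ) ^ z ∂ν) * φ₀ * conj φ₀)))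
              - (((T : ℝ) : ℂ) ^ (-(z + conj z' - 2)) / (z + conj z' - 2)) * ((∫ x in {x : (AdeleRing (𝓞 L) L)ˣ | (IdeleClassGroup.ideleNorm L x : ℝ) ≤ 1} ∩ 𝓕I, ((IdeleClassGroup.ideleNorm L x : ℝ) : ℂ) ∂νI) * (((μK.real Set.univ : ℝ) : ℂ) * ((∫ v : ↥(adelicUnipotent (↥(maximalRealSubfield L)) L (IsCMField.complexConj L) 3), (((borelHeight ((quasiSplit (↥(maximalRealSubfield L)) L (IsCMField.complexConj L) 3).toAdelic (weylLongU ((IsCMField.complexConj L : L ≃ₐ[↥(maximalRealSubfield L)] L) : L →+* L) (rfl : (StdForm.antidiagonal 3).over L = (StdForm.antidiagonal 3).over L)) * (v : (quasiSplit (↥(maximalRealSubfield L)) L (IsCMField.complexConj L) 3).Adelic))) : ℝ) : ℂ) ^ z ∂ν) * φ₀ * conj ((∫ v : ↥(adelicUnipotent (↥(maximalRealSubfield L)) L (IsCMField.complexConj L) 3), (((borelHeight ((quasiSplit (↥(maximalRealSubfield L)) L (IsCMField.complexConj L) 3).toAdelic (weylLongU ((IsCMField.complexConj L : L ≃ₐ[↥(maximalRealSubfield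 L)] L) : L →+* L) (rfl : (StdForm.antidiagonal 3).over L = (StdForm.antidiagonal 3).over L)) * (v : (quasiSplit (↥(maximalRealSubfield L)) L (IsCMField.complexConj L) 3).Adelic))) : ℝ) : ℂ) ^ z' ∂ν) * φ₀))))))) := by
  have hc : IsCMField.complexConj L * IsCMField.complexConj L = 1 :=
    AlgEquiv.ext fun y => by rw [AlgEquiv.mul_apply, AlgEquiv.one_apply, IsCMField.complexConj_apply_apply]
  haveI : ν.IsInvInvariant := isInvInvariant_of_isHaarMeasure_adelicUnipotent_three hc ν
  haveI : IsFiniteMeasure μ := inferInstance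
  obtain ⟨cμ, K, hcμ, hK, hconst⟩ := maassSelberg_flatSectionU_cm_three_final_const L μ νG μK νI h𝓕I ν h𝓕 h𝓕1 h𝓕c
  obtain ⟨F, hF, h₁, h₂, h₃, h₄⟩ := pairing_tube_cm_three L ν h𝓕 h𝓕c hT φ₀ μ
  refine ⟨cμ, K, hcμ, hK, F, hF, h₁, h₂, h₃, fun z z' hz' hzz' => ?_⟩
  obtain ⟨M₁, hM₁⟩ := exists_bound_sub_borelConstantTerm_sphericalEisenstein_cm_three_free L ν h𝓕 h𝓕c hT φ₀ (isCompact_singleton (x := z'))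
    (fun w hw => by rw [Set.mem_singleton_iff.1 hw]; exact hz')
  rw [h₄ z z' (hz'.trans hzz') hz']
  exact hconst hβ hT φ₀ φ₀ hz' hzz' (hM₁ z' (Set.mem_singleton z'))

end FourTerm

end Summit.HodgeConjecture.HodgeConjecture.Cruxes.H413.K2E1MaassSelbergPairingCMThree

end
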